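import Summits.Ventures.LatticeQCDFlow.Scaling.HubClassGlobalDomination

/-!
HONEST FRAMING: exact (Metropolis-corrected) sampling algorithms for lattice gauge theory; figures
of merit are autocorrelation/cost numbers at stated couplings and volumes; no continuum-physics
claim.

# TaggedPerStepDomination — CONJECTURE D PER STEP, OFF THE START CONTENT: FOR THE TWO TAGGED HUB CHAINS OF AN ADJACENT PAIR (W14∕W15∕W26'S `Option S` CHAINS, `X` TAGGING THE
# MORE PERSISTENT EXTRA PARTICLE), THE `j`-ATTEMPT HUB LAWS FROM A COMMON ORDINARY HUB `z` SATISFY `y_j(w) ≤ x_j(w)` FOR EVERY `j` AND EVERY ORDINARY CONTENT `w ≠ z` (lean-2 GEN-40, ours)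

Venture-side (OURS).  Cell `lqcd-flow` (pub-lqcd), unit `pub-lqcd-lean-2-g40`, 2026-08-30.  Chapter Z, file 4.  The setting and hypothesis-equations of W26 `tagged_hub_domination` VERBATIM:
ordinary composition `NC` (`Σ NC = K`), persistence `W > 0`, `acc(h,v) = min{1,W_h/W_v}`, the tagged chains `PX` (tag `a`) and `PY` (tag `b`) on `Option S` (`none` = ★; rows of absent
contents zero off the diagonal), `W_b ≤ W_a`.  W26 proved the DISCOUNTED domination `ỹ(w) ≤ x̃(w)` at every ordinary `w` and every `σ` (Conjecture M, by elimination).  Here, from Z3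
(`hubClass_global_domination` on the content type `Option S` with the tag as a present content of weight `1` and persistence `W_a` resp. `W_b`):

* `tagged_kernel_eq` (the tagged chain IS chapter W's hub kernel on `Option S` for the composition `NC ⊕ 1` and the persistence `W ⊕ W_tag`), `tagged_law_eq_pow` (the `j`-attempt law
  from `z` is the `z`-row of the `j`-th power);
* **`tagged_perStep_domination`**: for the `j`-attempt hub laws `x_j = δ_{z}PXʲ`, `y_j = δ_zPYʲ` from a common ordinary hub `z` (`NC(z) ≠ 0`): **`y_j(w) ≤ x_j(w)` for every `j` and every
  ordinary content `w ≠ z` with `NC(w) ≠ 0`** (absent contents carry no mass in either chain).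

So the per-step domination that route (β) of OPEN-MATH (b′) needs (MEMO-gen38∕39: the clock-conditioned coupling uses the `j`-attempt laws, whose defect `Σ_{c}(y_j(c) − x_j(c))⁺` must
vanish off the start content) is a theorem: the defect is confined to the start content `c = cont(z)`, where it does not vanish in general (Y5) and where the discounted form W20 holds.
Literature grade (cell rule): OWN; nothing cited; no new bib keys.
-/

open Finset

namespace Summit.Ventures.LatticeQCDFlow.Scaling

section TaggedPerStep
variable {S : Type*} [Fintype S] [DecidableEq S]
variable {W : S → ℝ} {acc : S → S → ℝ} {K : ℕ} {NC : S → ℕ} {a b : S} {PX PY : Option S → Option S → ℝ}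

/-- Sums over `Option S` with one `some` point erased: `Σ_{o ≠ some h} f(o) = f(none) + Σ_{v ≠ h} f(some v)`. [ours] -/
theorem tagged_sum_erase_some (f : Option S → ℝ) (h : S) : ∑ o ∈ univ.erase (some h), f o = f none + ∑ v ∈ univ.erase h, f (some v) := by
  rw [Finset.sum_erase_eq_sub (mem_univ _), Finset.sum_erase_eq_sub (mem_univ _), Fintype.sum_option]
  ring

/-- Sums over `Option S` with `none` erased: `Σ_{o ≠ none} f(o) = Σ_v f(some v)`. [ours] -/
theorem tagged_sum_erase_none (f : Option S → ℝ) : ∑ o ∈ univ.erase (none : Option S), f o = ∑ v, f (some v) := by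
  rw [Finset.sum_erase_eq_sub (mem_univ _), Fintype.sum_option]
  ring

/-- **The tagged chain is chapter W's hub kernel on `Option S`:** with the composition `N' = NC ⊕ 1` (`N'(none) = 1`), the persistence `W' = W ⊕ W_tag` and
`Kh'(N';h,v) = 𝟙{N'(h)≠0}(N'(v)/K)min{1,W'_h/W'_v}` off the diagonal (diagonal by the row sum), `P = Kh'(N')` entrywise. [ours] -/
theorem tagged_kernel_eq (hacc : ∀ h v, acc h v = min 1 (W h / W v)) {tag : S} {P : Option S → Option S → ℝ}
    (hPoff : ∀ h v, h ≠ v → P (some h) (some v) = if NC h = 0 then 0 else (NC v : ℝ) / K * acc h v)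
    (hPin : ∀ h, P (some h) none = if NC h = 0 then 0 else acc h tag / K)
    (hPdiag : ∀ h, P (some h) (some h) = 1 - (∑ v ∈ univ.erase h, P (some h) (some v) + P (some h) none))
    (hPout : ∀ v, P none (some v) = (NC v : ℝ) / K * acc tag v) (hPstay : P none none = 1 - ∑ v, P none (some v))
    {N' : Option S → ℕ} (hN' : ∀ o, N' o = Option.elim o 1 NC) {W' : Option S → ℝ} (hW' : ∀ o, W' o = Option.elim o (W tag) W)
    {Kh' : (Option S → ℕ) → Option S → Option S → ℝ}
    (hKoff : ∀ M h v, h ≠ v → Kh' M h v = if M h = 0 then 0 else (M v : ℝ) / K * min 1 (W' h / W' v))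
    (hKdiag : ∀ M h, Kh' M h h = 1 - ∑ v ∈ univ.erase h, Kh' M h v) (h v : Option S) : P h v = Kh' N' h v := by
  -- off-diagonal entries first
  have hoff : ∀ h v : Option S, h ≠ v → P h v = Kh' N' h v := by
    intro h v hhv
    rw [hKoff N' h v hhv]
    rcases h with _ | h <;> rcases v with _ | v
    · exact absurd rfl hhv
    · rw [hPout, hN', hN', hW', hW', hacc]; simp
    · rw [hPin, hN', hN', hW', hW', hacc]; simp; split_ifs <;> ring
    · have hhv' : h ≠ v := fun e => hhv (by rw [e])
      rw [hPoff h v hhv', hN', hN', hW', hW', hacc]; simp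
  by_cases hhv : h = v
  · subst hhv
    rw [hKdiag]
    rcases h with _ | h
    · rw [hPstay, tagged_sum_erase_none]
      exact congrArg _ (sum_congr rfl fun v _ => hoff _ _ (Option.some_ne_none v).symm)
    · rw [hPdiag, tagged_sum_erase_some, hoff _ _ (Option.some_ne_none h)]
      congr 1
      rw [add_comm]
      exact congrArg _ (sum_congr rfl fun v hv => hoff _ _ (fun e => (ne_of_mem_erase hv) (Option.some_injective _ e).symm))
  · exact hoff h v hhv

/-- **PER-STEP DOMINATION OFF THE START CONTENT FOR THE TAGGED CHAINS OF AN ADJACENT PAIR.**  In the setting of W26 (`X` tags the more persistent extra particle: `W_b ≤ W_a`), for the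
`j`-attempt hub laws `x_j`, `y_j` from a common ordinary hub `z`: `y_j(w) ≤ x_j(w)` for every `j` and every present ordinary content `w ≠ z`. [ours] -/
theorem tagged_perStep_domination (hW : ∀ v, 0 < W v) (hacc : ∀ h v, acc h v = min 1 (W h / W v)) (hK : 1 ≤ K) (hNC : ∑ v, NC v = K) (hab : W b ≤ W a)
    (hPXoff : ∀ h v, h ≠ v → PX (some h) (some v) = if NC h = 0 then 0 else (NC v : ℝ) / K * acc h v)
    (hPXin : ∀ h, PX (some h) none = if NC h = 0 then 0 else acc h a / K)
    (hPXdiag : ∀ h, PX (some h) (some h) = 1 - (∑ v ∈ univ.erase h, PX (some h) (some v) + PX (some h) none))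
    (hPXout : ∀ v, PX none (some v) = (NC v : ℝ) / K * acc a v) (hPXstay : PX none none = 1 - ∑ v, PX none (some v))
    (hPYoff : ∀ h v, h ≠ v → PY (some h) (some v) = if NC h = 0 then 0 else (NC v : ℝ) / K * acc h v)
    (hPYin : ∀ h, PY (some h) none = if NC h = 0 then 0 else acc h b / K)
    (hPYdiag : ∀ h, PY (some h) (some h) = 1 - (∑ v ∈ univ.erase h, PY (some h) (some v) + PY (some h) none))
    (hPYout : ∀ v, PY none (some v) = (NC v : ℝ) / K * acc b v) (hPYstay : PY none none = 1 - ∑ v, PY none (some v))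
    {z : S} (hz : NC z ≠ 0) {x y : ℕ → Option S → ℝ}
    (hx0 : ∀ v, x 0 v = if v = some z then 1 else 0) (hxs : ∀ n v, x (n + 1) v = ∑ h, x n h * PX h v)
    (hy0 : ∀ v, y 0 v = if v = some z then 1 else 0) (hys : ∀ n v, y (n + 1) v = ∑ h, y n h * PY h v)
    (n : ℕ) {w : S} (hwz : w ≠ z) (hw : NC w ≠ 0) : y n (some w) ≤ x n (some w) := by
  classical
  -- chapter W's data on the content type `Option S`
  obtain ⟨N', hN'⟩ : ∃ N' : Option S → ℕ, ∀ o, N' o = Option.elim o 1 NC := ⟨_, fun _ => rfl⟩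
  obtain ⟨WX', hWX'⟩ : ∃ W' : Option S → ℝ, ∀ o, W' o = Option.elim o (W a) W := ⟨_, fun _ => rfl⟩
  obtain ⟨WY', hWY'⟩ : ∃ W' : Option S → ℝ, ∀ o, W' o = Option.elim o (W b) W := ⟨_, fun _ => rfl⟩
  obtain ⟨accX', haccX'⟩ : ∃ acc' : Option S → Option S → ℝ, ∀ h v, acc' h v = min 1 (WX' h / WX' v) := ⟨_, fun _ _ => rfl⟩
  obtain ⟨accY', haccY'⟩ : ∃ acc' : Option S → Option S → ℝ, ∀ h v, acc' h v = min 1 (WY' h / WY' v) := ⟨_, fun _ _ => rfl⟩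
  obtain ⟨offX, hoffX⟩ : ∃ off : (Option S → ℕ) → Option S → Option S → ℝ, ∀ M h v, off M h v = if M h = 0 then 0 else (M v : ℝ) / K * accX' h v :=
    ⟨_, fun _ _ _ => rfl⟩
  obtain ⟨offY, hoffY⟩ : ∃ off : (Option S → ℕ) → Option S → Option S → ℝ, ∀ M h v, off M h v = if M h = 0 then 0 else (M v : ℝ) / K * accY' h v :=
    ⟨_, fun _ _ _ => rfl⟩
  obtain ⟨KhX, hKhX⟩ : ∃ Kh : (Option S → ℕ) → Option S → Option S → ℝ, ∀ M h v, Kh M h v = if h = v then 1 - ∑ v' ∈ univ.erase h, offX M h v' else offX M h v :=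
    ⟨_, fun _ _ _ => rfl⟩
  obtain ⟨KhY, hKhY⟩ : ∃ Kh : (Option S → ℕ) → Option S → Option S → ℝ, ∀ M h v, Kh M h v = if h = v then 1 - ∑ v' ∈ univ.erase h, offY M h v' else offY M h v :=
    ⟨_, fun _ _ _ => rfl⟩
  have hKXoff : ∀ M h v, h ≠ v → KhX M h v = if M h = 0 then 0 else (M v : ℝ) / K * min 1 (WX' h / WX' v) := fun M h v hhv => by
    rw [hKhX, if_neg hhv, hoffX, haccX']
  have hKYoff : ∀ M h v, h ≠ v → KhY M h v = if M h = 0 then 0 else (M v : ℝ) / K * min 1 (WY' h / WY' v) := fun M h v hhv => by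
    rw [hKhY, if_neg hhv, hoffY, haccY']
  have hKXoff' : ∀ M h v, h ≠ v → KhX M h v = if M h = 0 then 0 else (M v : ℝ) / K * accX' h v := fun M h v hhv => by rw [hKXoff M h v hhv, haccX']
  have hKYoff' : ∀ M h v, h ≠ v → KhY M h v = if M h = 0 then 0 else (M v : ℝ) / K * accY' h v := fun M h v hhv => by rw [hKYoff M h v hhv, haccY']
  have hKXdiag : ∀ M h, KhX M h h = 1 - ∑ v ∈ univ.erase h, KhX M h v := fun M h => by
    rw [hKhX, if_pos rfl]; congr 1; exact sum_congr rfl fun v hv => by rw [hKhX, if_neg (ne_of_mem_erase hv).symm]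
  have hKYdiag : ∀ M h, KhY M h h = 1 - ∑ v ∈ univ.erase h, KhY M h v := fun M h => by
    rw [hKhY, if_pos rfl]; congr 1; exact sum_congr rfl fun v hv => by rw [hKhY, if_neg (ne_of_mem_erase hv).symm]
  -- the tagged chains are these kernels
  have hPX : ∀ h v, PX h v = KhX N' h v := tagged_kernel_eq hacc hPXoff hPXin hPXdiag hPXout hPXstay hN' hWX' hKXoff hKXdiag
  have hPY : ∀ h v, PY h v = KhY N' h v := tagged_kernel_eq hacc hPYoff hPYin hPYdiag hPYout hPYstay hN' hWY' hKYoff hKYdiag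
  -- the matrix powers
  let KhnX : ℕ → Option S → Option S → ℝ := fun n =>
    Nat.rec (motive := fun _ => Option S → Option S → ℝ) (fun h v => if h = v then 1 else 0) (fun _ prev h v => ∑ w', prev h w' * KhX N' w' v) n
  let KhnY : ℕ → Option S → Option S → ℝ := fun n =>
    Nat.rec (motive := fun _ => Option S → Option S → ℝ) (fun h v => if h = v then 1 else 0) (fun _ prev h v => ∑ w', prev h w' * KhY N' w' v) n
  have hKhnX0 : ∀ h v, KhnX 0 h v = if h = v then 1 else 0 := fun _ _ => rfl
  have hKhnXs : ∀ n h v, KhnX (n + 1) h v = ∑ w', KhnX n h w' * KhX N' w' v := fun _ _ _ => rfl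
  have hKhnY0 : ∀ h v, KhnY 0 h v = if h = v then 1 else 0 := fun _ _ => rfl
  have hKhnYs : ∀ n h v, KhnY (n + 1) h v = ∑ w', KhnY n h w' * KhY N' w' v := fun _ _ _ => rfl
  have hxrow : ∀ n v, x n v = KhnX n (some z) v := by
    intro n; induction n with
    | zero => intro v; rw [hx0, hKhnX0]; by_cases h : v = some z <;> simp [h, eq_comm]
    | succ n ih => intro v; rw [hxs, hKhnXs]; exact sum_congr rfl fun h _ => by rw [ih, hPX]
  have hyrow : ∀ n v, y n v = KhnY n (some z) v := by
    intro n; induction n with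
    | zero => intro v; rw [hy0, hKhnY0]; by_cases h : v = some z <;> simp [h, eq_comm]
    | succ n ih => intro v; rw [hys, hKhnYs]; exact sum_congr rfl fun h _ => by rw [ih, hPY]
  -- the hypotheses of Z3
  have hWXpos : ∀ o, 0 < WX' o := fun o => by rw [hWX']; rcases o with _ | v <;> simp [hW]
  have hWYpos : ∀ o, 0 < WY' o := fun o => by rw [hWY']; rcases o with _ | v <;> simp [hW]
  have hagree : ∀ o, o ≠ none → WX' o = WY' o := fun o ho => by
    rcases o with _ | v
    · exact absurd rfl ho
    · rw [hWX', hWY']; rfl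
  have hWt : WY' none ≤ WX' none := by rw [hWX', hWY']; exact hab
  have hNK : ∑ o, (N' o : ℝ) ≤ K + 1 := by
    have h1 : ∑ o, (N' o : ℝ) = 1 + ∑ v, (NC v : ℝ) := by rw [Fintype.sum_option]; simp [hN', Option.elim]
    have h2 : ∑ v, (NC v : ℝ) = K := by exact_mod_cast hNC
    rw [h1, h2]; linarith
  have hNt : N' none ≠ 0 := by rw [hN']; simp
  have hzw' : (some z : Option S) ≠ some w := fun e => hwz (Option.some_injective _ e).symm
  have hres := hubClass_global_domination (S := Option S) hK hNK hNt hWXpos hWYpos hagree hWt haccX' haccY' hKXoff' hKXdiag hKYoff' hKYdiag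
    hKhnX0 hKhnXs hKhnY0 hKhnYs n hzw' (Option.some_ne_none z) (Option.some_ne_none w) (by rw [hN']; exact hz) (by rw [hN']; exact hw)
  rw [hxrow, hyrow]
  exact hres

end TaggedPerStep

end Summit.Ventures.LatticeQCDFlow.Scaling
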